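import Literature.MathematicalPhysics.QuantumFieldTheory.Balaban1983to89.B7BlockAvgLog
import Literature.MathematicalPhysics.QuantumFieldTheory.Balaban1983to89.B8

/-!
# `Balaban1983to89.B8Ineq170` — the chain (1.70)–(1.74) of B8 pp. 88–89 as kernel arithmetic, with the
# region level `j` and the constant in the (1.69)-slot as free parameters (the level-`k` re-run included)

CITATION HEADER (lean-in-tree rule 2026-08-18).  Kernel arithmetic for one displayed derivation of
T. Bałaban, *Spaces of regular gauge field configurations on a lattice and gauge fixing conditions*, Comm. Math.
Phys. **99**, 75–102 (1985) [Balaban1985RegularSpaces] (cell paper B8 of the audit cell `pub-balaban`;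
`paper:balaban1985-cmp99-regular-spaces-gauge-fixing`, journal page = PDF page + 74), pp. 88–89 [PDF 14–15], and of
the inputs it takes from [3] = T. Bałaban, *Averaging operations for lattice gauge theories*, Comm. Math. Phys. **98**,
17–51 (1985) [Balaban1985Averaging] (cell paper B7; journal page = PDF page + 16), pp. 21, 33, 37–38 [PDF 5, 17,
21–22].  Renders re-read AS IMAGES by the filing unit on 2026-08-19: `…1985-cmp99-regular-spaces-gauge-fixing-p014-x2.png`,
`-p015-x2.png`; `…1985-cmp98-averaging-p017-x2.png`, `-p021-x2.png`, `-p022-x2.png` (p005/p006 for (21)–(27) as read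
by `MatrixLog`).  The papers are manuscripts UNDER ADJUDICATION by the cell; nothing of them is asserted here: every
printed input is an explicit binder and the file proves only normed-algebra inequalities and real arithmetic.

PRINTED (B8 p. 88, after (1.68)–(1.69)): "Let us consider the gauge transformation u₁. From (64)–(87) of [3] it
follows that u₁ is determined uniquely in terms of U₁ and is given by (106). From (105) and (106) we have for
x ∈ B^j(Λ_j),
|u₁(x) − 1| ≦ Σ_{n=j−1}^{0} (|(\overline{R̄^n_{0,x_{n+1}}U̿^n_1}) − 1| + |(R̄^n_{0,x_{n+1}}U̿^n_1)(Γ_{x_{n+1},x_n}) − 1|)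
≦ 2 Σ_{n=0}^{j−1} max_{x∈B(x_{n+1})} |(1/i) log(R̄^n_{0,x_{n+1}}U̿^n_1)(Γ_{x_{n+1},x})|. (1.70)
Using (130) and (1.69) we obtain
|(1/i) log(R̄^n_{0,x_{n+1}}U̿^n_1)(Γ_{x_{n+1},x})| ≦ |Q_n(U₀, ηA)|(Γ_{x_{n+1},x}) + O((|Q_n(U₀, ηA)|(Γ_{x_{n+1},x}))²)
< 2B₁(α₀ + α₁)L^{n−j}dL + O((2B₁(α₀ + α₁)L^{n−j}dL)²) ≦ 4dB₁(α₀ + α₁)L^{n+1−j} (1.71)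
for α₀ + α₁ sufficiently small, hence
|u₁(x) − 1| < 8dB₁(α₀ + α₁) · 1/(1 − L⁻¹) ≦ 16dB₁(α₀ + α₁), x ∈ Ω₀. (1.72)
The same argument can be applied to the averages \overline{R₀u₁}^n, and we get
|(\overline{R₀u₁}^n)(x_n) − 1| < 16dB₁(α₀ + α₁), x_n ∈ Ω_n^{(n)}. (1.73)"
PRINTED (B8 p. 89): "From (108) and (1.71) we obtain also
|(\overline{R₀u₁}^n)⁻¹(x_{n+1})(R̄^n_{0,x_{n+1}}\overline{R₀u₀}^n)(x_n) − 1| < 4dB₁(α₀ + α₁)L^{n+1−j} (1.74)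
for x_n ∈ B(x_{n+1}), x_{n+1} ∈ B^{j−n−1}(Λ_j), n = 0, …, j − 1, j = 1, …, k − 1 (we take Λ_{k−1}∪B(Λ_k) as Λ_{k−1})."
and (1.69), p. 88: "U₁ = U′^{u₁⁻¹} = e^{iLηA′} = e^{iηA}, |A| < B₁(α₀ + α₁)(L^jη)⁻¹, |∇^η_{U₀}A| < B₁(α₀ + α₁)(L^jη)⁻² on Ω_j,
j = 0, 1, …, k − 1. (1.69)".
PRINTED ([3] p. 33): "(\overline{R̄^j_{0,x_{j+1}}U̿^j_1}) = exp[i Σ_{x∈B(x_{j+1})} L^{−d} (1/i) log(R̄^j_{0,x_{j+1}}U̿^j_1)(Γ_{x_{j+1},x})]. (105)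
… u(x) = Π_{j=k−1}^{0} (R(U₀(Γ^{(j+1)}_{x_{j+1},x})))⁻¹[(\overline{R̄^j_{0,x_{j+1}}U̿^j_1})⁻¹(R̄^j_{0,x_{j+1}}U̿^j_1)(Γ_{x_{j+1},x_j})],
(106)  and this gives the formulas
(\overline{R₀u})^j(x_j) = Π_{l=k−1}^{j} (R(Ū^j_0(Γ^{(l+1−j)}_{x_{l+1},x_j})))⁻¹ · [(\overline{R̄^l_{0,x_{l+1}}U̿^l_1})⁻¹(R̄^l_{0,x_{l+1}}U̿^l_1)(Γ_{x_{l+1},x_l})], (107)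
(\overline{R₀u}^j)⁻¹(x_{j+1})R(Ū^j_0(Γ_{x_{j+1},x_j}))(\overline{R₀u}^j)(x_j) = (R̄^j_{0,x_{j+1}}U̿^j_1)(Γ_{x_{j+1},x_j}). (108)"
PRINTED ([3] p. 38): "|(1/(L^jη)) Q_j(U₀, ηA) − Q_j(U₀)A| < e^{O(1)(L^{2j}+…+L⁴+L²)η²α₀} · 4C₁(L^j + … + L² + L)ηα₁². (130)
This implies |(1/(L^jη)) Q_j(U₀, ηA)| < … < e^{O(1)2α₀}(1 + 8C₁α₁)α₁ < 2α₁, (131)" (under "U₁ = e^{iηA}, |A| < α₁",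
p. 37; Proposition 4, p. 38: "Q_k(U₀, ηA, c) = (1/i) log(Ū^k_1)_c, c ⊂ Ω^{(k)}, is an analytic function of the variables
A_b, b ⊂ B^k(c₋)∪B^k(c₊)").  PRINTED ([3] p. 21): "|U − 1| = max_j |e^{iλ_j} − 1| = … ≦ max_j |λ_j| = |log U|, (24)".

READING (the dictionary under which the displayed steps are normed-algebra facts; the cell's convention, not the
paper's words).  `R(g)` in (101)–(108) of [3] is read as the adjoint action `X ↦ gXg⁻¹` of the (unitary) frame `g`;
all that (1.70) uses of it is `|R(g)⁻¹[Y] − 1| = |Y − 1|` (an isometric, unit-preserving action), typed here as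
conjugation by a unitary.  So every factor of (106)/(107) is a unitary conjugate
`g⋆ · [d⋆ · w] · g` of `(dbar)⁻¹ · (path variable)`, with `g` the frame `U₀(Γ^{(n+1)}_{x_{n+1},x})` (unitary),
`d = \overline{R̄^n_{0,x_{n+1}}U̿^n_1}` the double bar (105) — an `exp` of `i×` the `L^{−d}`-weighted average of the
path logarithms `X_{n,x} := (1/i) log(R̄^n_{0,x_{n+1}}U̿^n_1)(Γ_{x_{n+1},x})`, `x ∈ B(x_{n+1})` (self-adjoint, the
logarithm (23) of a unitary) — and `w = (R̄^n_{0,x_{n+1}}U̿^n_1)(Γ_{x_{n+1},x_n}) = exp(iX_{n,x_n})` ((21): `exp ∘ log = id`).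
The norm is the operator norm (19) of [3]; the typed carrier is an arbitrary unital C⋆-algebra `A` (matrices under
the `L²`-operator norm being the instance, as in `MatrixLog`), the (106)-product is typed over any normed ring.

WHAT THE TREE ALREADY HAS.  `B8` (reader r1 / sub-cell B08): the statement-level skeleton of Theorem 4 in which
(1.73)–(1.74) are OPAQUE predicates (`GaugeCalc.Reg7374`, `GaugeCalcL.RegLev m` / `RegPr`, § (iii-c)/(iii-d)) and the
level-`k` re-run of (1.70)–(1.74) for a level-`k` solution is the NAMED BINDER `B8.Rerun7074AtK` (census G-A23-1:
"a derivation the paper does not print for u₁"); `B8.ineq172` (`8d/(1 − L⁻¹) ≤ 16d`).  `MatrixLog` (f1-g4): (24) as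
`norm_expUnitary_sub_one_le` (`‖e^{ix} − 1‖ ≤ ‖x‖`, x self-adjoint, any C⋆-algebra).  `B7Transfer` (b07-g2):
`norm_conj_sub_one_le`, `convex_comb_norm_le`.  `B7Prop6Bound` (adv1): `oprod`, `geom_tail_le`.  `B7BlockAvgLog`
(b07-g3): the double-bar carrier `barAvg t wt W = exp(i Σ_x wt_x (1/i) log W_x)` of (42)/(78)/(82)/(105)/(110) and
the (160)–(163) chain of [3] p. 42 — which is the SAME engine as (1.70)–(1.72) (one double bar per level there, a
double bar and a path variable per level here; `α₁` there ↦ `B₁(α₀ + α₁)(L^jη)⁻¹` here, `L^{n+1}η` ↦ `L^{n+1−j}`).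

WHAT THIS FILE ADDS (kernel-checked; new sibling module, nothing above is edited).
§1 (normed ring) `dprod F m = F(m−1)⋯F(0)` — the DESCENDING ordered product of (106)/(107) — with the LINEAR
   telescoping `‖dprod F m − 1‖ ≤ Σ_{n<m} ‖F n − 1‖` under `‖F n‖ ≤ 1` (`norm_dprod_sub_one_le`; the first `≦` of
   (1.70) is linear, not the product form of `B7Prop6Bound.prod_sub_one_norm_le`), `‖d⁻¹ − 1‖ ≤ ‖d − 1‖`
   (`norm_inv_sub_one_le`) and the one-level bound `‖g(d′w)g′ − 1‖ ≤ ‖d′ − 1‖ + ‖w − 1‖` (`norm_levelFactor_sub_one_le`).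
§2 (C⋆-algebra) the double bar (105) `dbar t wt X = exp(i Σ_x wt_x X_x)` on the Lie-algebra side (`dbar_eq_barAvg`:
   it IS `B7BlockAvgLog.barAvg t wt P` when `X_x = (1/i) log P_x`), its unitarity, `‖dbar − 1‖ ≤ max_x ‖X_x‖` and
   `‖exp(iX) − 1‖ ≤ ‖X‖` ((24) of [3]); the level factor `levelFactor` = `g⋆(dbar⋆ · exp(iX_{x_n}))g`, the products
   `u106` (= (106), levels `0 ≤ n < j`) and `avg107 n₀` (= (107), levels `n₀ ≤ n < j`); **(1.70)** both lines, for
   any window of levels (`ineq170_window`: `‖Π − 1‖ ≤ Σ_n (‖dbar_n − 1‖ + ‖w_n − 1‖) ≤ 2 Σ_n M_n`, `M_n` any common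
   bound of the `‖X_{n,x}‖`, `x ∈ B(x_{n+1})` — in print their max).
§3 (real arithmetic) **(1.71)**: the path bound `|Q_n|(Γ) < 2Bσ L^{n−j}·dL` from per-bond bounds `< 2BσL^{n−j}`
   ("Using (130) and (1.69)": (130)–(131) of [3] per bond, LOCALISED, with the slot bound `|A| < Bσ(L^jη)⁻¹` for
   [3]'s global `α₁`; `σ = α₀ + α₁`) over `≤ d(L − 1)` bonds (`ineq171_pathQ_lt`); the absorption of the
   second-order remainder `O((|Q_n|(Γ))²)` of the first `≦` of (1.71) (the logarithm of the path product against
   the sum of its bond exponents), typed with an EXPLICIT constant `C` for the paper's `O(·)` — `M ≤ Q + CQ²`,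
   `Q < P`, `CP ≤ 1 ⇒ M < 2P` (`ineq171_abs`) — giving `M_n < 4dBσL^{n+1−j}` under the explicit smallness
   `2CdBσ ≤ 1` that the print calls "for α₀ + α₁ sufficiently small" (`ineq171`); **(1.72)**: `Σ_{n<j} L^{n+1−j}
   ≤ 1/(1 − L⁻¹) ≤ 2` (`geom_range_le`, by the recursion `S_{j+1} = S_j/L + 1`; `geom_Ico_le` for a window) and
   `2 Σ_{n∈[n₀,j)} M_n < 8dBσ/(1 − L⁻¹) ≤ 16dBσ` (`ineq172_window`, strict as printed, from strict (1.71)).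
§4 (assembly) **(1.72)/(1.73)** `‖avg107 n₀ j − 1‖ < 8dBσ/(1 − L⁻¹) ≤ 16dBσ` for every window `n₀ ≤ j` — `n₀ = 0` is
   (1.72) for `u₁(x)`, `x ∈ B^j(Λ_j)`, general `n₀ = n` is (1.73) for `(\overline{R₀u₁}^n)(x_n)` via (107)
   (`ineq172_173`); **(1.74)** `‖exp(iX_{n,x_n}) − 1‖ < 4dBσL^{n+1−j}` — the left side of (1.74) IS this path variable
   by (108) (`ineq174`); and the whole chain from the slot inputs in one statement (`chain7074_of_slot`).
§5 LEVEL BOOKKEEPING (census G-A23-1, `B8.Rerun7074AtK`).  Every theorem above is uniform in the region level `j`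
   and in the slot constant `B`: NOTHING in (1.70)–(1.74) refers to the top level `k` except through the RANGE of
   `j` and the SOURCE of the bound in the (1.69)-slot.  The printed instances are `j ≤ k − 1` with `B = B₁` from
   (1.69) (`printedRange_7374`); the instances `j ≤ k` with `B = B′₁` from (1.62)/(1.67) (`|A| < B′₁(α₀ + α₁)(L^jη)⁻¹`
   on `Ω_j`, `j ≤ k` — "the conditions of the theorem" that p. 95 grants the two solutions) are word for word the
   "level-k re-run" that `B8.Rerun7074AtK` names (`rerunRange_7374`; its hypothesis is `C162 B₁' (α₀ + α₁)`) — so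
   that binder asks of the paper exactly: (106)/(107)/(108) of [3] for a `u` obeying the level-`k` gauge conditions
   (1.29)_k ([3] (64)–(87) at `k` levels), the localised (130)–(131) of [3] at the levels `n < j ≤ k` with the
   (1.62)-bound in the slot, and the smallness `2CdB′₁(α₀ + α₁) ≤ 1` — a SEPARATE explicit constraint on the `c₁` of
   Theorem 4, stricter than the printed `2CdB₁(α₀ + α₁) ≤ 1` whenever `B₁ ≤ B′₁` (`smallness_rerun_implies_printed`;
   `B′₁ = C′₁B₁`, `C′₁ = (2 + 16B′₀)L ≥ 1` in the reading of `B8.thm2_of_thm4_prop3` — (1.67) prints `B′₁ = C′₁5B₀`,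
   print slip G-B8-02), which p. 95's "For α₀ + α₁ sufficiently small the assumptions of this proposition are
   satisfied" absorbs; the resulting constants are `α₃ = 16dB′₁(α₀ + α₁)` in (1.73) and `4dB′₁(α₀ + α₁)L^{n+1−j}` in
   (1.74) (B8 § (iii-c): "with B′₁ for B₁").  (B8 § (iii-c) also records that Proposition 3 at level `k` restores
   (1.69) with `B₁` itself on every `Ω_j`, `j ≤ k`; with that input the re-run is the `B = B₁`, `j ≤ k` instance —
   either way ONE theorem.)  The binder itself is NOT discharged here (B8's carriers `GFData`/`GaugeCalcL` are
   abstract; an instance must identify `RegLev` with these bounds) — this file supplies the derivation such an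
   instance would invoke, at every level.
NOT TYPED (inputs that stay paper-side, each a named binder or a reading above): (106)–(108) themselves (the
representation of `u₁` by [3] (64)–(87)); (130)–(131) of [3] and their LOCALISATION to `Ω_j` with the local bound
(1.69)/(1.62) in place of the global `|A| < α₁` of [3] p. 37 (Proposition 4's analyticity clause, p. 38, makes
`Q_k(U₀, ηA, c)` a function of `A_b`, `b ⊂ B^k(c₋) ∪ B^k(c₊)` only) — the per-bond binder `q_b < 2BσL^{n−j}`; the
first `≦` of (1.71) itself — the logarithm of the path product `(R̄^n_{0,x_{n+1}}U̿^n_1)(Γ)` is the sum of its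
(transported) bond exponents up to `O(square)` (the expansion behind (28) of [3], p. 22) — which enters as the binder
`M ≤ Q + CQ²` with the `O`-constant `C` explicit; the identification of the series logarithm (21)
with the spectral logarithm (23) for a unitary close to `1` (`MatrixLog`, finding (ii)) — here the path logarithms
`X_{n,x}` are the primary data and `w`, `dbar` are DEFINED from them by (21)/(105), which is the direction the
estimates use.  Print has `max`; typed: any common bound `M_n`.  Value = kernel certificate of a printed derivation
+ the level-uniformity of the unprinted re-run made visible in the type, NOT summit progress.  Unit
`b2b-balaban-b08` gen 11 (journal claim C-B8-32-CHAIN170-KERNEL; census C-B8-32, DIVERGENCE D-b08-g11.1).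
-/

noncomputable section

open NormedSpace Finset

namespace Literature.MathematicalPhysics.QuantumFieldTheory.Balaban1983to89.B8Ineq170

open B7Prop6Bound B7Transfer B7BlockAvgLog MatrixLog

/-! ## §1 The descending product of (106)/(107) in a normed ring and the first `≦` of (1.70) -/

section Ring

variable {𝔸 : Type*} [NormedRing 𝔸]

/-- The DESCENDING ordered product `dprod F m = F(m−1) · F(m−2) ⋯ F(0)` — the shape `Π_{j=k−1}^{0}` of (106) and
`Π_{l=k−1}^{j}` of (107) of [3] (the tree's `B7Prop6Bound.oprod` is the ascending one). [cite: Balaban1985Averaging, (106)–(107) p.33] -/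
def dprod (F : ℕ → 𝔸) : ℕ → 𝔸
  | 0 => 1
  | m + 1 => F m * dprod F m

/-- The empty descending product is `1`. [folklore] -/
@[simp] theorem dprod_zero (F : ℕ → 𝔸) : dprod F 0 = 1 := rfl

/-- `dprod F (m+1) = F(m) · dprod F m`: the new (highest-level) factor multiplies on the LEFT, as in (106). [folklore] -/
theorem dprod_succ (F : ℕ → 𝔸) (m : ℕ) : dprod F (m + 1) = F m * dprod F m := rfl

/-- `‖ab − 1‖ ≤ ‖a − 1‖ + ‖b − 1‖` when `‖a‖ ≤ 1` (`ab − 1 = a(b − 1) + (a − 1)`). [folklore] -/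
theorem norm_mul_sub_one_le_of_norm_le_one {a b : 𝔸} (ha : ‖a‖ ≤ 1) :
    ‖a * b - 1‖ ≤ ‖a - 1‖ + ‖b - 1‖ := by
  have h : a * b - 1 = a * (b - 1) + (a - 1) := by noncomm_ring
  rw [h]
  calc ‖a * (b - 1) + (a - 1)‖ ≤ ‖a * (b - 1)‖ + ‖a - 1‖ := norm_add_le _ _
    _ ≤ ‖a‖ * ‖b - 1‖ + ‖a - 1‖ := by gcongr; exact norm_mul_le _ _
    _ ≤ 1 * ‖b - 1‖ + ‖a - 1‖ := by gcongr
    _ = ‖a - 1‖ + ‖b - 1‖ := by ring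

/-- **First `≦` of (1.70)**, abstractly: LINEAR telescoping `‖F(m−1)⋯F(0) − 1‖ ≤ Σ_{n<m} ‖F(n) − 1‖` for factors of
norm `≤ 1` (unitaries). [cite: Balaban1985RegularSpaces, (1.70) p.88] -/
theorem norm_dprod_sub_one_le (F : ℕ → 𝔸) (m : ℕ) (hF : ∀ n < m, ‖F n‖ ≤ 1) :
    ‖dprod F m - 1‖ ≤ ∑ n ∈ range m, ‖F n - 1‖ := by
  induction m with
  | zero => simp [dprod]
  | succ m ih =>
    rw [dprod_succ, sum_range_succ]
    have hFm : ‖F m‖ ≤ 1 := hF m (Nat.lt_succ_self m)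
    have ih' := ih fun n hn => hF n (Nat.lt_succ_of_lt hn)
    calc ‖F m * dprod F m - 1‖ ≤ ‖F m - 1‖ + ‖dprod F m - 1‖ := norm_mul_sub_one_le_of_norm_le_one hFm
      _ ≤ ‖F m - 1‖ + ∑ n ∈ range m, ‖F n - 1‖ := by gcongr
      _ = (∑ n ∈ range m, ‖F n - 1‖) + ‖F m - 1‖ := by ring

/-- `‖d⁻¹ − 1‖ ≤ ‖d − 1‖` for a right inverse of norm `≤ 1` (`d⁻¹ − 1 = (1 − d)d⁻¹`): the print's
`|(\overline{…}) − 1|` in (1.70) for the factor `(\overline{…})⁻¹` of (106). [folklore] -/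
theorem norm_inv_sub_one_le {d dI : 𝔸} (hd : d * dI = 1) (hdI : ‖dI‖ ≤ 1) : ‖dI - 1‖ ≤ ‖d - 1‖ := by
  have h : dI - 1 = (1 - d) * dI := by rw [sub_mul, one_mul, hd]
  rw [h]
  calc ‖(1 - d) * dI‖ ≤ ‖1 - d‖ * ‖dI‖ := norm_mul_le _ _
    _ ≤ ‖1 - d‖ * 1 := by gcongr
    _ = ‖d - 1‖ := by rw [mul_one, norm_sub_rev]

/-- One level of (106): `‖g(d′w)g′ − 1‖ ≤ ‖d′ − 1‖ + ‖w − 1‖` for a frame `gg′ = 1` of norms `≤ 1` (conjugation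
`R(·)⁻¹`, `B7Transfer.norm_conj_sub_one_le`) and `‖d′‖ ≤ 1`. [cite: Balaban1985RegularSpaces, (1.70) p.88] -/
theorem norm_levelFactor_sub_one_le {g g' dI w : 𝔸} (hgg' : g * g' = 1) (hg : ‖g‖ ≤ 1) (hg' : ‖g'‖ ≤ 1)
    (hdI : ‖dI‖ ≤ 1) : ‖g * (dI * w) * g' - 1‖ ≤ ‖dI - 1‖ + ‖w - 1‖ :=
  (norm_conj_sub_one_le g (dI * w) g' hgg' hg hg').trans (norm_mul_sub_one_le_of_norm_le_one hdI)

end Ring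

/-! ## §2 The double bar (105) and the path variable on the Lie-algebra side; (1.70) in a C⋆-algebra -/

section CStar

open Complex selfAdjoint Unitary

variable {A : Type*} [CStarAlgebra A]

/-- A unitary has norm `≤ 1` (`= 1` unless the algebra is trivial); the `[CStarAlgebra A]` instance of the tree's
`QuantumLattice.CorrelationLightCone.norm_le_one_of_mem_unitary` (re-proved in four lines rather than importing a
cross-topic module into the B-package). [folklore] -/
theorem cstar_unitary_norm_le_one {u : A} (hu : u ∈ unitary A) : ‖u‖ ≤ 1 := by
  rcases subsingleton_or_nontrivial A with h | h
  · simp [Subsingleton.elim u 0]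
  · exact (CStarRing.norm_of_mem_unitary hu).le

/-- `exp(iX)` is unitary for self-adjoint `X` (Mathlib's `selfAdjoint.expUnitary`). [folklore] -/
theorem exp_I_smul_mem_unitary {X : A} (hX : IsSelfAdjoint X) : exp (I • X) ∈ unitary A := by
  have h := (selfAdjoint.expUnitary ⟨X, hX⟩).prop
  simpa [selfAdjoint.expUnitary_coe] using h

/-- **(24) of [3]** in the form used by (1.70): `‖exp(iX) − 1‖ ≤ ‖X‖` for self-adjoint `X`
(`MatrixLog.norm_expUnitary_sub_one_le`). [cite: Balaban1985Averaging, (24) p.21] -/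
theorem norm_exp_I_smul_sub_one_le {X : A} (hX : IsSelfAdjoint X) : ‖exp (I • X) - 1‖ ≤ ‖X‖ := by
  have h := MatrixLog.norm_expUnitary_sub_one_le (⟨X, hX⟩ : selfAdjoint A)
  simpa [selfAdjoint.expUnitary_coe] using h

/-- **The double bar (105)** on the Lie-algebra side: `dbar t wt X = exp[i Σ_{x∈t} wt_x X_x]` — in print `t = B(x_{n+1})`,
`wt_x = L^{−d}`, `X_x = (1/i) log(R̄^n_{0,x_{n+1}}U̿^n_1)(Γ_{x_{n+1},x})`. [cite: Balaban1985Averaging, (105) p.33] -/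
def dbar {ι : Type*} (t : Finset ι) (wt : ι → ℝ) (X : ι → A) : A :=
  exp (I • ∑ x ∈ t, wt x • X x)

/-- (105) read as printed: when `X_x = (1/i) log P_x` ((21) of [3], `MatrixLog.mlog`) the double bar IS the tree's
block-average carrier `B7BlockAvgLog.barAvg t wt P`. [cite: Balaban1985Averaging, (105) p.33] -/
theorem dbar_eq_barAvg {ι : Type*} (t : Finset ι) (wt : ι → ℝ) (X P : ι → A)
    (hXP : ∀ x ∈ t, X x = (I⁻¹ : ℂ) • mlog (P x)) : dbar t wt X = barAvg t wt P := by
  unfold dbar barAvg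
  congr 2
  exact Finset.sum_congr rfl fun x hx => by rw [hXP x hx]

/-- A real-weighted sum of self-adjoint elements is self-adjoint. [folklore] -/
theorem isSelfAdjoint_wsum {ι : Type*} (t : Finset ι) (wt : ι → ℝ) (X : ι → A)
    (hX : ∀ x ∈ t, IsSelfAdjoint (X x)) : IsSelfAdjoint (∑ x ∈ t, wt x • X x) :=
  isSelfAdjoint_sum t fun x hx => (IsSelfAdjoint.all (wt x)).smul (hX x hx)

/-- The double bar is unitary. [folklore] -/
theorem dbar_mem_unitary {ι : Type*} (t : Finset ι) (wt : ι → ℝ) (X : ι → A)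
    (hX : ∀ x ∈ t, IsSelfAdjoint (X x)) : dbar t wt X ∈ unitary A :=
  exp_I_smul_mem_unitary (isSelfAdjoint_wsum t wt X hX)

/-- `|(\overline{…}) − 1| ≤ max_{x∈B(x_{n+1})} |X_x|`: (24) of [3] for the double bar, then the `L^{−d}`-average is a
convex combination (`B7Transfer.convex_comb_norm_le`); `M` is any common bound of the `‖X_x‖` (print: their max).
[cite: Balaban1985RegularSpaces, (1.70) p.88] [cite: Balaban1985Averaging, (24) p.21, (105) p.33] -/
theorem norm_dbar_sub_one_le {ι : Type*} (t : Finset ι) (wt : ι → ℝ) (X : ι → A) {M : ℝ}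
    (hX : ∀ x ∈ t, IsSelfAdjoint (X x)) (hw : ∀ x ∈ t, 0 ≤ wt x) (hsum : ∑ x ∈ t, wt x = 1)
    (hM : ∀ x ∈ t, ‖X x‖ ≤ M) : ‖dbar t wt X - 1‖ ≤ M :=
  (norm_exp_I_smul_sub_one_le (isSelfAdjoint_wsum t wt X hX)).trans
    (convex_comb_norm_le t wt X hw hsum hM)

variable {ι : Type*}

/-- **One factor of (106)/(107)** at level `n`: `R(g_n)⁻¹[(\overline{…})⁻¹ · (R̄^n_{0,x_{n+1}}U̿^n_1)(Γ_{x_{n+1},x_n})]`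
= `g_n⋆ · (dbar_n⋆ · exp(iX_{n,x_n})) · g_n` — frame `g n` (in print `U₀(Γ^{(n+1)}_{x_{n+1},x})`, unitary; for (107)
`Ū^j_0(Γ^{(l+1−j)}_{x_{l+1},x_j})`), block `t n = B(x_{n+1})` with weights `wt n` and path logarithms `X n`, chain site
`xs n = x_n ∈ B(x_{n+1})`. [cite: Balaban1985Averaging, (106)–(107) p.33] -/
def levelFactor (t : ℕ → Finset ι) (wt : ℕ → ι → ℝ) (X : ℕ → ι → A) (xs : ℕ → ι) (g : ℕ → A) (n : ℕ) : A :=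
  star (g n) * (star (dbar (t n) (wt n) (X n)) * exp (I • X n (xs n))) * g n

/-- **(107)**: `(\overline{R₀u})^{n₀}(x_{n₀})` = the descending product of the level factors over the window
`n₀ ≤ n < j` (`j` = the number of levels of the representation, in B8 the region level of `x ∈ B^j(Λ_j)`).
[cite: Balaban1985Averaging, (107) p.33] -/
def avg107 (t : ℕ → Finset ι) (wt : ℕ → ι → ℝ) (X : ℕ → ι → A) (xs : ℕ → ι) (g : ℕ → A) (n₀ j : ℕ) : A :=
  dprod (fun i => levelFactor t wt X xs g (n₀ + i)) (j - n₀)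

/-- **(106)**: `u(x)` = the descending product of all `j` level factors (the window `0 ≤ n < j`).
[cite: Balaban1985Averaging, (106) p.33] -/
def u106 (t : ℕ → Finset ι) (wt : ℕ → ι → ℝ) (X : ℕ → ι → A) (xs : ℕ → ι) (g : ℕ → A) (j : ℕ) : A :=
  dprod (levelFactor t wt X xs g) j

/-- (106) is the window `n₀ = 0` of (107). [cite: Balaban1985Averaging, (106)–(107) p.33] -/
theorem u106_eq_avg107 (t : ℕ → Finset ι) (wt : ℕ → ι → ℝ) (X : ℕ → ι → A) (xs : ℕ → ι) (g : ℕ → A) (j : ℕ) :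
    u106 t wt X xs g j = avg107 t wt X xs g 0 j := by
  unfold u106 avg107
  simp only [Nat.zero_add, Nat.sub_zero]

/-- The level factor is unitary (a product of unitaries). [folklore] -/
theorem levelFactor_mem_unitary (t : ℕ → Finset ι) (wt : ℕ → ι → ℝ) (X : ℕ → ι → A) (xs : ℕ → ι)
    (g : ℕ → A) (n : ℕ) (hX : ∀ x ∈ t n, IsSelfAdjoint (X n x)) (hxs : xs n ∈ t n) (hg : g n ∈ unitary A) :
    levelFactor t wt X xs g n ∈ unitary A := by
  unfold levelFactor
  exact mul_mem (mul_mem (Unitary.star_mem hg)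
    (mul_mem (Unitary.star_mem (dbar_mem_unitary _ _ _ hX)) (exp_I_smul_mem_unitary (hX _ hxs)))) hg

/-- One level factor deviates from `1` by at most `|(\overline{…}) − 1| + |(…)(Γ_{x_{n+1},x_n}) − 1|` — the summand
of the first line of (1.70). [cite: Balaban1985RegularSpaces, (1.70) p.88] -/
theorem norm_levelFactor_sub_one_le' (t : ℕ → Finset ι) (wt : ℕ → ι → ℝ) (X : ℕ → ι → A) (xs : ℕ → ι)
    (g : ℕ → A) (n : ℕ) (hX : ∀ x ∈ t n, IsSelfAdjoint (X n x)) (hg : g n ∈ unitary A) :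
    ‖levelFactor t wt X xs g n - 1‖ ≤ ‖dbar (t n) (wt n) (X n) - 1‖ + ‖exp (I • X n (xs n)) - 1‖ := by
  have hd := dbar_mem_unitary (t n) (wt n) (X n) hX
  have hdI : ‖star (dbar (t n) (wt n) (X n))‖ ≤ 1 := cstar_unitary_norm_le_one (Unitary.star_mem hd)
  calc ‖levelFactor t wt X xs g n - 1‖
      ≤ ‖star (dbar (t n) (wt n) (X n)) - 1‖ + ‖exp (I • X n (xs n)) - 1‖ :=
        norm_levelFactor_sub_one_le (Unitary.star_mul_self_of_mem hg)
          (cstar_unitary_norm_le_one (Unitary.star_mem hg)) (cstar_unitary_norm_le_one hg) hdI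
    _ ≤ ‖dbar (t n) (wt n) (X n) - 1‖ + ‖exp (I • X n (xs n)) - 1‖ := by
        gcongr
        exact norm_inv_sub_one_le (Unitary.mul_star_self_of_mem hd) hdI

/-- **(1.70), both lines, for any window of levels `n₀ ≤ n < j`** (so for `u₁(x)` via (106), `n₀ = 0`, and for the
averages `(\overline{R₀u₁}^n)(x_n)` via (107), `n₀ = n`, "The same argument can be applied to the averages"):
`|Π − 1| ≦ Σ_n (|(\overline{…})_n − 1| + |(…)(Γ_{x_{n+1},x_n}) − 1|) ≦ 2 Σ_n M_n`, where `M_n` bounds the path logarithms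
`‖X_{n,x}‖`, `x ∈ B(x_{n+1})` (print: `max`).  Hypotheses: the `X_{n,x}` self-adjoint, convex weights, `x_n ∈ B(x_{n+1})`,
unitary frames. [cite: Balaban1985RegularSpaces, (1.70) p.88] [cite: Balaban1985Averaging, (24) p.21, (105)–(107) p.33] -/
theorem ineq170_window (n₀ j : ℕ) (t : ℕ → Finset ι) (wt : ℕ → ι → ℝ) (X : ℕ → ι → A) (xs : ℕ → ι)
    (g : ℕ → A) (M : ℕ → ℝ)
    (hX : ∀ n ∈ Ico n₀ j, ∀ x ∈ t n, IsSelfAdjoint (X n x))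
    (hw : ∀ n ∈ Ico n₀ j, ∀ x ∈ t n, 0 ≤ wt n x) (hsum : ∀ n ∈ Ico n₀ j, ∑ x ∈ t n, wt n x = 1)
    (hxs : ∀ n ∈ Ico n₀ j, xs n ∈ t n) (hg : ∀ n ∈ Ico n₀ j, g n ∈ unitary A)
    (hM : ∀ n ∈ Ico n₀ j, ∀ x ∈ t n, ‖X n x‖ ≤ M n) :
    ‖avg107 t wt X xs g n₀ j - 1‖
        ≤ ∑ n ∈ Ico n₀ j, (‖dbar (t n) (wt n) (X n) - 1‖ + ‖exp (I • X n (xs n)) - 1‖) ∧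
      ∑ n ∈ Ico n₀ j, (‖dbar (t n) (wt n) (X n) - 1‖ + ‖exp (I • X n (xs n)) - 1‖)
        ≤ 2 * ∑ n ∈ Ico n₀ j, M n := by
  have hmem : ∀ i < j - n₀, n₀ + i ∈ Ico n₀ j := fun i hi => mem_Ico.mpr ⟨Nat.le_add_right _ _, by omega⟩
  refine ⟨?_, ?_⟩
  · have h1 := norm_dprod_sub_one_le (fun i => levelFactor t wt X xs g (n₀ + i)) (j - n₀) fun i hi =>
      cstar_unitary_norm_le_one (levelFactor_mem_unitary t wt X xs g (n₀ + i) (hX _ (hmem i hi))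
        (hxs _ (hmem i hi)) (hg _ (hmem i hi)))
    have h2 : ∑ i ∈ range (j - n₀), ‖levelFactor t wt X xs g (n₀ + i) - 1‖
        ≤ ∑ i ∈ range (j - n₀), (‖dbar (t (n₀ + i)) (wt (n₀ + i)) (X (n₀ + i)) - 1‖
            + ‖exp (I • X (n₀ + i) (xs (n₀ + i))) - 1‖) :=
      sum_le_sum fun i hi => norm_levelFactor_sub_one_le' t wt X xs g (n₀ + i)
        (hX _ (hmem i (mem_range.mp hi))) (hg _ (hmem i (mem_range.mp hi)))
    rw [← sum_Ico_eq_sum_range (f := fun n => ‖dbar (t n) (wt n) (X n) - 1‖ + ‖exp (I • X n (xs n)) - 1‖)]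
      at h2
    exact h1.trans h2
  · rw [mul_sum]
    refine sum_le_sum fun n hn => ?_
    have hd : ‖dbar (t n) (wt n) (X n) - 1‖ ≤ M n :=
      norm_dbar_sub_one_le (t n) (wt n) (X n) (hX n hn) (hw n hn) (hsum n hn) (hM n hn)
    have hwv : ‖exp (I • X n (xs n)) - 1‖ ≤ M n :=
      (norm_exp_I_smul_sub_one_le (hX n hn _ (hxs n hn))).trans (hM n hn _ (hxs n hn))
    linarith

end CStar

/-! ## §3 The real arithmetic of (1.71) and (1.72) -/

section Arith

/-- The path bound in (1.71): per-bond bounds `q_b < 2BσL^{n−j}` ((130)–(131) of [3], `|(1/(L^nη))Q_n| < 2α₁`,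
LOCALISED with the (1.69)-slot bound `Bσ(L^jη)⁻¹` for [3]'s global `α₁`, `σ = α₀ + α₁` — "Using (130) and (1.69)")
over the `s ≦ d(L − 1)` bonds of `Γ_{x_{n+1},x}` give `|Q_n(U₀, ηA)|(Γ_{x_{n+1},x}) = Σ_b q_b < 2BσL^{n−j}·dL`
(`L^{n−j}` typed `L^n/L^j`). [cite: Balaban1985RegularSpaces, (1.71) p.88] [cite: Balaban1985Averaging, (130)–(131) p.38] -/
theorem ineq171_pathQ_lt (q : ℕ → ℝ) (s : ℕ) {d L B σ : ℝ} {n j : ℕ}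
    (hs : (s : ℝ) ≤ d * (L - 1)) (hd : 0 < d) (hL : 1 ≤ L) (hB : 0 < B) (hσ : 0 < σ)
    (hq : ∀ b < s, q b < 2 * B * σ * (L ^ n / L ^ j)) :
    ∑ b ∈ range s, q b < 2 * B * σ * (L ^ n / L ^ j) * (d * L) := by
  have hL0 : 0 < L := by linarith
  have hc : 0 < 2 * B * σ * (L ^ n / L ^ j) := by positivity
  rcases Nat.eq_zero_or_pos s with hs0 | hs0
  · subst hs0
    simp only [range_zero, sum_empty]
    positivity
  · have hne : (range s).Nonempty := ⟨0, mem_range.mpr hs0⟩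
    calc ∑ b ∈ range s, q b < ∑ _b ∈ range s, 2 * B * σ * (L ^ n / L ^ j) :=
          sum_lt_sum_of_nonempty hne fun b hb => hq b (mem_range.mp hb)
      _ = s * (2 * B * σ * (L ^ n / L ^ j)) := by rw [sum_const, card_range, nsmul_eq_mul]
      _ ≤ d * (L - 1) * (2 * B * σ * (L ^ n / L ^ j)) := by gcongr
      _ < d * L * (2 * B * σ * (L ^ n / L ^ j)) := by
          have : d * (L - 1) < d * L := by nlinarith
          exact mul_lt_mul_of_pos_right this hc
      _ = 2 * B * σ * (L ^ n / L ^ j) * (d * L) := by ring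

/-- The absorption step of (1.71) with the paper's `O(·)` as an explicit constant `C ≥ 0`: `M ≦ Q + CQ²` (the first
`≦` of (1.71): the logarithm of the path product is the sum `Q` of its bond exponents' sizes up to second order),
`0 ≦ Q < P` and `CP ≦ 1` give `M < P + CP² ≦ 2P`. [cite: Balaban1985RegularSpaces, (1.71) p.88] -/
theorem ineq171_abs {M Q C P : ℝ} (hC : 0 ≤ C) (hQ0 : 0 ≤ Q) (h130 : M ≤ Q + C * Q ^ 2)
    (hQP : Q < P) (hCP : C * P ≤ 1) : M < 2 * P := by
  have hP : 0 ≤ P := hQ0.trans hQP.le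
  have hQ2 : Q ^ 2 ≤ P ^ 2 := pow_le_pow_left₀ hQ0 hQP.le 2
  have h1 : C * Q ^ 2 ≤ C * P ^ 2 := mul_le_mul_of_nonneg_left hQ2 hC
  have h2 : C * P ^ 2 ≤ P := by
    have : C * P ^ 2 = (C * P) * P := by ring
    rw [this]
    exact mul_le_of_le_one_left hP hCP
  linarith

/-- `L^a/L^b ≤ 1` for `a ≤ b`, `L ≥ 1` (here: `L^{n+1−j} ≤ 1` for `n < j`). [folklore] -/
theorem pow_div_pow_le_one {L : ℝ} (hL : 1 ≤ L) {a b : ℕ} (hab : a ≤ b) : L ^ a / L ^ b ≤ 1 := by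
  have hL0 : 0 < L := by linarith
  rw [div_le_one (pow_pos hL0 b)]
  exact pow_le_pow_right₀ hL hab

/-- **(1.71)**: `|(1/i) log(…)(Γ_{x_{n+1},x})| =: M < 4dBσL^{n+1−j}` for `n < j`, from `M ≦ Q + CQ²`, `0 ≦ Q < 2BσL^{n−j}dL`
(= `2dBσL^{n+1−j} ≦ 2dBσ`) and the EXPLICIT smallness `2CdBσ ≦ 1` — the print's "for α₀ + α₁ sufficiently small"
(`σ = α₀ + α₁ ≦ 1/(2CdB)`). [cite: Balaban1985RegularSpaces, (1.71) p.88] -/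
theorem ineq171 {M Q C d L B σ : ℝ} {n j : ℕ} (hn : n < j) (hL : 1 ≤ L) (hC : 0 ≤ C)
    (hd : 0 ≤ d) (hB : 0 ≤ B) (hσ : 0 ≤ σ) (hQ0 : 0 ≤ Q) (h130 : M ≤ Q + C * Q ^ 2)
    (hQ : Q < 2 * B * σ * (L ^ n / L ^ j) * (d * L)) (hsmall : 2 * C * d * B * σ ≤ 1) :
    M < 4 * d * B * σ * (L ^ (n + 1) / L ^ j) := by
  have hL0 : 0 < L := by linarith
  have hP : 2 * B * σ * (L ^ n / L ^ j) * (d * L) = 2 * d * B * σ * (L ^ (n + 1) / L ^ j) := by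
    rw [pow_succ]; ring
  rw [hP] at hQ
  have hr : L ^ (n + 1) / L ^ j ≤ 1 := pow_div_pow_le_one hL (by omega)
  have hr0 : 0 ≤ L ^ (n + 1) / L ^ j := by positivity
  have hCP : C * (2 * d * B * σ * (L ^ (n + 1) / L ^ j)) ≤ 1 := by
    have h0 : 0 ≤ 2 * C * d * B * σ := by positivity
    calc C * (2 * d * B * σ * (L ^ (n + 1) / L ^ j)) = 2 * C * d * B * σ * (L ^ (n + 1) / L ^ j) := by ring
      _ ≤ 2 * C * d * B * σ * 1 := by gcongr
      _ ≤ 1 := by linarith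
  have h := ineq171_abs hC hQ0 h130 hQ hCP
  linarith

/-- The geometric sum of (1.72): `Σ_{n<j} L^{n+1−j} = Σ_{m<j} L^{−m} ≦ 1/(1 − L⁻¹)` (`= L/(L − 1)`), by the recursion
`S_{j+1} = S_j/L + 1` whose fixed point is `L/(L − 1)`; `L > 1`. [cite: Balaban1985RegularSpaces, (1.72) p.88] -/
theorem geom_range_le (L : ℝ) (hL : 1 < L) (j : ℕ) :
    ∑ n ∈ range j, L ^ (n + 1) / L ^ j ≤ 1 / (1 - L⁻¹) := by
  have hL0 : 0 < L := by linarith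
  have hT : 1 / (1 - L⁻¹) = L / (L - 1) := by
    field_simp
  rw [hT]
  induction j with
  | zero => simp only [range_zero, sum_empty]; positivity
  | succ j ih =>
    have hrec : ∑ n ∈ range (j + 1), L ^ (n + 1) / L ^ (j + 1)
        = (∑ n ∈ range j, L ^ (n + 1) / L ^ j) / L + 1 := by
      rw [sum_range_succ, sum_div]
      congr 1
      · refine sum_congr rfl fun n _ => ?_
        rw [pow_succ L j]; field_simp
      · field_simp
    rw [hrec]
    have hL1 : 0 < L - 1 := by linarith
    calc (∑ n ∈ range j, L ^ (n + 1) / L ^ j) / L + 1 ≤ L / (L - 1) / L + 1 := by gcongr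
      _ = L / (L - 1) := by field_simp; ring

/-- The same bound for a window of levels `n₀ ≤ n < j` (the sum in (1.73)). [cite: Balaban1985RegularSpaces, (1.72)–(1.73) p.88] -/
theorem geom_Ico_le (L : ℝ) (hL : 1 < L) (n₀ j : ℕ) :
    ∑ n ∈ Ico n₀ j, L ^ (n + 1) / L ^ j ≤ 1 / (1 - L⁻¹) := by
  have hL0 : 0 < L := by linarith
  calc ∑ n ∈ Ico n₀ j, L ^ (n + 1) / L ^ j ≤ ∑ n ∈ range j, L ^ (n + 1) / L ^ j :=
        sum_le_sum_of_subset_of_nonneg (fun n hn => mem_range.mpr (mem_Ico.mp hn).2)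
          fun n _ _ => by positivity
    _ ≤ 1 / (1 - L⁻¹) := geom_range_le L hL j

/-- `1/(1 − L⁻¹) ≦ 2` for `L ≧ 2` (the last `≦` of (1.72); cf. `B8.ineq172`). [cite: Balaban1985RegularSpaces, (1.72) p.88] -/
theorem one_div_one_sub_inv_le_two {L : ℝ} (hL : 2 ≤ L) : 1 / (1 - L⁻¹) ≤ 2 := by
  have hL0 : 0 < L := by linarith
  have hinv : L⁻¹ ≤ 1 / 2 := by rw [inv_le_comm₀ hL0 (by norm_num)]; simpa using hL
  rw [div_le_iff₀ (by linarith)]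
  linarith

/-- `0 < 1/(1 − L⁻¹)` for `L > 1`. [folklore] -/
theorem one_div_one_sub_inv_pos {L : ℝ} (hL : 1 < L) : 0 < 1 / (1 - L⁻¹) := by
  have hL0 : 0 < L := by linarith
  have : L⁻¹ < 1 := inv_lt_one_of_one_lt₀ hL
  positivity

/-- **(1.72)/(1.73), sum form**: strict per-level bounds (1.71) `M_n < 4dBσL^{n+1−j}` on a window `n₀ ≤ n < j` give
`2 Σ_n M_n < 8dBσ · 1/(1 − L⁻¹) ≦ 16dBσ` (`L ≧ 2`; `d, B, σ > 0` — for the empty window the left side is `0`).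
[cite: Balaban1985RegularSpaces, (1.72)–(1.73) p.88] -/
theorem ineq172_window (n₀ j : ℕ) (M : ℕ → ℝ) {d B σ L : ℝ} (hL : 2 ≤ L) (hd : 0 < d) (hB : 0 < B)
    (hσ : 0 < σ) (h171 : ∀ n ∈ Ico n₀ j, M n < 4 * d * B * σ * (L ^ (n + 1) / L ^ j)) :
    2 * ∑ n ∈ Ico n₀ j, M n < 8 * d * B * σ * (1 / (1 - L⁻¹)) ∧
      8 * d * B * σ * (1 / (1 - L⁻¹)) ≤ 16 * d * B * σ := by
  have hL1 : 1 < L := by linarith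
  have hT0 := one_div_one_sub_inv_pos hL1
  have hc : 0 < 8 * d * B * σ := by positivity
  refine ⟨?_, ?_⟩
  · rcases (Ico n₀ j).eq_empty_or_nonempty with he | hne
    · rw [he, sum_empty, mul_zero]; positivity
    · calc 2 * ∑ n ∈ Ico n₀ j, M n < 2 * ∑ n ∈ Ico n₀ j, 4 * d * B * σ * (L ^ (n + 1) / L ^ j) := by
            gcongr with n hn
            exact h171 n hn
        _ = 8 * d * B * σ * ∑ n ∈ Ico n₀ j, L ^ (n + 1) / L ^ j := by
            rw [mul_sum, mul_sum]; exact sum_congr rfl fun n _ => by ring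
        _ ≤ 8 * d * B * σ * (1 / (1 - L⁻¹)) := by gcongr; exact geom_Ico_le L hL1 n₀ j
  · calc 8 * d * B * σ * (1 / (1 - L⁻¹)) ≤ 8 * d * B * σ * 2 := by
          gcongr; exact one_div_one_sub_inv_le_two hL
      _ = 16 * d * B * σ := by ring

end Arith

/-! ## §4 Assembly: (1.72), (1.73), (1.74), and the chain from the slot inputs -/

section Assembly

open Complex selfAdjoint Unitary

variable {A : Type*} [CStarAlgebra A] {ι : Type*}

/-- **(1.72) and (1.73)**: for a window of levels `n₀ ≤ n < j` with the (106)/(107) data of §2 and per-level bounds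
`M_n` of the path logarithms obeying (1.71) strictly, `|Π − 1| < 8dBσ/(1 − L⁻¹) ≦ 16dBσ` — `n₀ = 0`: (1.72) for
`u₁(x)`, `x ∈ B^j(Λ_j)` (via `u106_eq_avg107`); `n₀ = n`: (1.73) for `(\overline{R₀u₁}^n)(x_n)`, `x_n ∈ Ω_n^{(n)}`.
[cite: Balaban1985RegularSpaces, (1.72)–(1.73) p.88] [cite: Balaban1985Averaging, (106)–(107) p.33] -/
theorem ineq172_173 (n₀ j : ℕ) (t : ℕ → Finset ι) (wt : ℕ → ι → ℝ) (X : ℕ → ι → A) (xs : ℕ → ι)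
    (g : ℕ → A) (M : ℕ → ℝ) {d B σ L : ℝ}
    (hX : ∀ n ∈ Ico n₀ j, ∀ x ∈ t n, IsSelfAdjoint (X n x))
    (hw : ∀ n ∈ Ico n₀ j, ∀ x ∈ t n, 0 ≤ wt n x) (hsum : ∀ n ∈ Ico n₀ j, ∑ x ∈ t n, wt n x = 1)
    (hxs : ∀ n ∈ Ico n₀ j, xs n ∈ t n) (hg : ∀ n ∈ Ico n₀ j, g n ∈ unitary A)
    (hM : ∀ n ∈ Ico n₀ j, ∀ x ∈ t n, ‖X n x‖ ≤ M n)
    (hL : 2 ≤ L) (hd : 0 < d) (hB : 0 < B) (hσ : 0 < σ)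
    (h171 : ∀ n ∈ Ico n₀ j, M n < 4 * d * B * σ * (L ^ (n + 1) / L ^ j)) :
    ‖avg107 t wt X xs g n₀ j - 1‖ < 8 * d * B * σ * (1 / (1 - L⁻¹)) ∧
      8 * d * B * σ * (1 / (1 - L⁻¹)) ≤ 16 * d * B * σ := by
  obtain ⟨h1, h2⟩ := ineq170_window n₀ j t wt X xs g M hX hw hsum hxs hg hM
  obtain ⟨h3, h4⟩ := ineq172_window n₀ j M hL hd hB hσ h171
  exact ⟨lt_of_le_of_lt (h1.trans h2) h3, h4⟩

/-- **(1.72)** for `u₁(x)` itself ((106), all `j` levels). [cite: Balaban1985RegularSpaces, (1.72) p.88] -/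
theorem ineq172 (j : ℕ) (t : ℕ → Finset ι) (wt : ℕ → ι → ℝ) (X : ℕ → ι → A) (xs : ℕ → ι)
    (g : ℕ → A) (M : ℕ → ℝ) {d B σ L : ℝ}
    (hX : ∀ n < j, ∀ x ∈ t n, IsSelfAdjoint (X n x))
    (hw : ∀ n < j, ∀ x ∈ t n, 0 ≤ wt n x) (hsum : ∀ n < j, ∑ x ∈ t n, wt n x = 1)
    (hxs : ∀ n < j, xs n ∈ t n) (hg : ∀ n < j, g n ∈ unitary A)
    (hM : ∀ n < j, ∀ x ∈ t n, ‖X n x‖ ≤ M n)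
    (hL : 2 ≤ L) (hd : 0 < d) (hB : 0 < B) (hσ : 0 < σ)
    (h171 : ∀ n < j, M n < 4 * d * B * σ * (L ^ (n + 1) / L ^ j)) :
    ‖u106 t wt X xs g j - 1‖ < 8 * d * B * σ * (1 / (1 - L⁻¹)) ∧
      8 * d * B * σ * (1 / (1 - L⁻¹)) ≤ 16 * d * B * σ := by
  have hI : ∀ n ∈ Ico 0 j, n < j := fun n hn => (mem_Ico.mp hn).2
  rw [u106_eq_avg107]
  exact ineq172_173 0 j t wt X xs g M (fun n hn => hX n (hI n hn)) (fun n hn => hw n (hI n hn))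
    (fun n hn => hsum n (hI n hn)) (fun n hn => hxs n (hI n hn)) (fun n hn => hg n (hI n hn))
    (fun n hn => hM n (hI n hn)) hL hd hB hσ (fun n hn => h171 n (hI n hn))

/-- **(1.74)**: by (108) of [3] the left side of (1.74) IS the path variable `(R̄^n_{0,x_{n+1}}U̿^n_1)(Γ_{x_{n+1},x_n})
= exp(iX_{n,x_n})`, and `|exp(iX) − 1| ≦ |X| ≦ M_n < 4dBσL^{n+1−j}` by (24) of [3] and (1.71).
[cite: Balaban1985RegularSpaces, (1.74) p.89] [cite: Balaban1985Averaging, (108) p.33, (24) p.21] -/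
theorem ineq174 {X : A} (hX : IsSelfAdjoint X) {M P : ℝ} (hM : ‖X‖ ≤ M) (h171 : M < P) :
    ‖exp (I • X) - 1‖ < P :=
  lt_of_le_of_lt ((norm_exp_I_smul_sub_one_le hX).trans hM) h171

/-- **The B7-side inputs of the chain at region level `j` with slot constant `B`** (everything (1.70)–(1.74) consume
from [3] and from the bound in the (1.69)-slot, per level `n < j`): a bond count `s n ≦ d(L − 1)` of `Γ_{x_{n+1},x}`,
per-bond sizes `q n b ≧ 0` with `q n b < 2BσL^{n−j}` ((130)–(131) of [3], localised, × the slot bound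
`|A| < Bσ(L^jη)⁻¹` on `Ω_j` — "Using (130) and (1.69)"), and the first `≦` of (1.71), `M n ≦ Q_n + C·Q_n²`,
`Q_n = Σ_b q n b` (the logarithm of the path product against the sum of its bond exponents), with an explicit
remainder constant `C ≧ 0` for the print's `O(·)`, `M n` being the common bound of the path logarithms `‖X_{n,x}‖`,
`x ∈ B(x_{n+1})`.  In print
`B = B₁` (from (1.69), `j ≦ k − 1`); for the level-`k` re-run `B = B′₁` (from (1.62), `j ≦ k`).  A hypothesis
SHAPE; nothing of [3] is asserted. [cite: Balaban1985RegularSpaces, (1.69)–(1.71) p.88, (1.62) p.87] [cite: Balaban1985Averaging, (130)–(131) p.38] -/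
structure SlotInputs (j : ℕ) (d L B σ C : ℝ) (M : ℕ → ℝ) : Prop where
  perLevel : ∀ n < j, ∃ (s : ℕ) (q : ℕ → ℝ),
    (s : ℝ) ≤ d * (L - 1) ∧ (∀ b < s, 0 ≤ q b) ∧ (∀ b < s, q b < 2 * B * σ * (L ^ n / L ^ j)) ∧
      M n ≤ (∑ b ∈ range s, q b) + C * (∑ b ∈ range s, q b) ^ 2

/-- **(1.71) from the slot inputs**: `M_n < 4dBσL^{n+1−j}` for every `n < j`, under `2CdBσ ≦ 1`.
[cite: Balaban1985RegularSpaces, (1.71) p.88] -/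
theorem ineq171_of_slot {j : ℕ} {d L B σ C : ℝ} {M : ℕ → ℝ} (slot : SlotInputs j d L B σ C M)
    (hL : 1 ≤ L) (hC : 0 ≤ C) (hd : 0 < d) (hB : 0 < B) (hσ : 0 < σ) (hsmall : 2 * C * d * B * σ ≤ 1) :
    ∀ n < j, M n < 4 * d * B * σ * (L ^ (n + 1) / L ^ j) := by
  intro n hn
  obtain ⟨s, q, hs, hq0, hq, h130⟩ := slot.perLevel n hn
  have hQ0 : 0 ≤ ∑ b ∈ range s, q b := sum_nonneg fun b hb => hq0 b (mem_range.mp hb)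
  have hQ := ineq171_pathQ_lt q s hs hd hL hB hσ hq
  exact ineq171 hn hL hC hd.le hB.le hσ.le hQ0 h130 hQ hsmall

/-- **The whole chain (1.70)–(1.74) at region level `j` with slot constant `B`, from the slot inputs**: for the
(106)/(107) data of §2 (self-adjoint path logarithms bounded by `M_n` on `B(x_{n+1})`, convex weights, unitary
frames, `x_n ∈ B(x_{n+1})`), `L ≧ 2`, `d, B, σ > 0`, `C ≧ 0` and the smallness `2CdBσ ≦ 1`:
(1.72)/(1.73) `|(\overline{R₀u₁}^{n₀})(x_{n₀}) − 1| < 16dBσ` for every `n₀ ≦ j` (`n₀ = 0`: `u₁(x)`), and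
(1.74) `|(…)(Γ_{x_{n+1},x_n}) − 1| < 4dBσL^{n+1−j}` for every `n < j`. [cite: Balaban1985RegularSpaces, (1.70)–(1.74) pp.88–89] -/
theorem chain7074_of_slot (j : ℕ) (t : ℕ → Finset ι) (wt : ℕ → ι → ℝ) (X : ℕ → ι → A) (xs : ℕ → ι)
    (g : ℕ → A) (M : ℕ → ℝ) {d L B σ C : ℝ}
    (hX : ∀ n < j, ∀ x ∈ t n, IsSelfAdjoint (X n x))
    (hw : ∀ n < j, ∀ x ∈ t n, 0 ≤ wt n x) (hsum : ∀ n < j, ∑ x ∈ t n, wt n x = 1)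
    (hxs : ∀ n < j, xs n ∈ t n) (hg : ∀ n < j, g n ∈ unitary A)
    (hM : ∀ n < j, ∀ x ∈ t n, ‖X n x‖ ≤ M n)
    (hL : 2 ≤ L) (hd : 0 < d) (hB : 0 < B) (hσ : 0 < σ) (hC : 0 ≤ C) (hsmall : 2 * C * d * B * σ ≤ 1)
    (slot : SlotInputs j d L B σ C M) :
    (∀ n₀ ≤ j, ‖avg107 t wt X xs g n₀ j - 1‖ < 16 * d * B * σ) ∧
      (∀ n < j, ‖exp (I • X n (xs n)) - 1‖ < 4 * d * B * σ * (L ^ (n + 1) / L ^ j)) := by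
  have h171 := ineq171_of_slot slot (by linarith) hC hd hB hσ hsmall
  have hI : ∀ n₀, ∀ n ∈ Ico n₀ j, n < j := fun n₀ n hn => (mem_Ico.mp hn).2
  refine ⟨fun n₀ _ => ?_, fun n hn => ineq174 (hX n hn _ (hxs n hn)) (hM n hn _ (hxs n hn)) (h171 n hn)⟩
  obtain ⟨h1, h2⟩ := ineq172_173 n₀ j t wt X xs g M (fun n hn => hX n (hI n₀ n hn))
    (fun n hn => hw n (hI n₀ n hn)) (fun n hn => hsum n (hI n₀ n hn)) (fun n hn => hxs n (hI n₀ n hn))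
    (fun n hn => hg n (hI n₀ n hn)) (fun n hn => hM n (hI n₀ n hn)) hL hd hB hσ
    (fun n hn => h171 n (hI n₀ n hn))
  exact lt_of_lt_of_le h1 h2

end Assembly

/-! ## §5 Level bookkeeping: the printed range and the level-`k` re-run are instances of ONE statement -/

section Levels

open Complex

variable {A : Type*} [CStarAlgebra A] {ι : Type*}

/-- The conclusions of the chain at region level `j` with constant `a = 16dBσ` in (1.73) and `4dBσL^{n+1−j}` in
(1.74), for given (106)/(107) data — the content an instance of `B8.GaugeCalcL.RegLev` would carry at ONE region
level. [cite: Balaban1985RegularSpaces, (1.73)–(1.74) pp.88–89] -/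
def Concl7374 (t : ℕ → Finset ι) (wt : ℕ → ι → ℝ) (X : ℕ → ι → A) (xs : ℕ → ι) (g : ℕ → A)
    (j : ℕ) (d L B σ : ℝ) : Prop :=
  (∀ n₀ ≤ j, ‖avg107 t wt X xs g n₀ j - 1‖ < 16 * d * B * σ) ∧
    (∀ n < j, ‖exp (I • X n (xs n)) - 1‖ < 4 * d * B * σ * (L ^ (n + 1) / L ^ j))

/-- The hypotheses of the chain at region level `j` with slot constant `B`: the §2 data conditions and the slot
inputs. [cite: Balaban1985RegularSpaces, (1.69)–(1.71) p.88] -/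
def Hyps7374 (t : ℕ → Finset ι) (wt : ℕ → ι → ℝ) (X : ℕ → ι → A) (xs : ℕ → ι) (g : ℕ → A) (M : ℕ → ℝ)
    (j : ℕ) (d L B σ C : ℝ) : Prop :=
  (∀ n < j, ∀ x ∈ t n, IsSelfAdjoint (X n x)) ∧ (∀ n < j, ∀ x ∈ t n, 0 ≤ wt n x) ∧
    (∀ n < j, ∑ x ∈ t n, wt n x = 1) ∧ (∀ n < j, xs n ∈ t n) ∧ (∀ n < j, g n ∈ unitary A) ∧
    (∀ n < j, ∀ x ∈ t n, ‖X n x‖ ≤ M n) ∧ SlotInputs j d L B σ C M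

/-- **The chain, uniformly in the region level `j` and the slot constant `B`.** [cite: Balaban1985RegularSpaces, (1.70)–(1.74) pp.88–89] -/
theorem chain7374 (t : ℕ → Finset ι) (wt : ℕ → ι → ℝ) (X : ℕ → ι → A) (xs : ℕ → ι) (g : ℕ → A)
    (M : ℕ → ℝ) (j : ℕ) {d L B σ C : ℝ} (hL : 2 ≤ L) (hd : 0 < d) (hB : 0 < B) (hσ : 0 < σ) (hC : 0 ≤ C)
    (hsmall : 2 * C * d * B * σ ≤ 1) (h : Hyps7374 t wt X xs g M j d L B σ C) :
    Concl7374 t wt X xs g j d L B σ := by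
  obtain ⟨hX, hw, hsum, hxs, hg, hM, slot⟩ := h
  exact chain7074_of_slot j t wt X xs g M hX hw hsum hxs hg hM hL hd hB hσ hC hsmall slot

/-- **The PRINTED range** (pp. 88–89: `j = 1, …, k − 1`, slot constant `B₁` from (1.69), "(we take Λ_{k−1}∪B(Λ_k) as
Λ_{k−1})") — the regularity `B8.GaugeCalcL.RegPr` that Sect. D consumes: the chain at every `j ≦ k − 1` (level-`j`
data indexed by `j`). [cite: Balaban1985RegularSpaces, (1.73)–(1.74) pp.88–89] -/
theorem printedRange_7374 (k : ℕ) (t : ℕ → ℕ → Finset ι) (wt : ℕ → ℕ → ι → ℝ) (X : ℕ → ℕ → ι → A)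
    (xs : ℕ → ℕ → ι) (g : ℕ → ℕ → A) (M : ℕ → ℕ → ℝ) {d L B₁ σ C : ℝ} (hL : 2 ≤ L) (hd : 0 < d)
    (hB : 0 < B₁) (hσ : 0 < σ) (hC : 0 ≤ C) (hsmall : 2 * C * d * B₁ * σ ≤ 1)
    (h : ∀ j ≤ k - 1, Hyps7374 (t j) (wt j) (X j) (xs j) (g j) (M j) j d L B₁ σ C) :
    ∀ j ≤ k - 1, Concl7374 (t j) (wt j) (X j) (xs j) (g j) j d L B₁ σ :=
  fun j hj => chain7374 (t j) (wt j) (X j) (xs j) (g j) (M j) j hL hd hB hσ hC hsmall (h j hj)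

/-- **The level-`k` RE-RUN** (p. 95, census G-A23-1; the binder `B8.Rerun7074AtK` of `B8` § (iii-d), i.e. "(1.73),
(1.74) with k instead of k − 1" = `B8.GaugeCalcL.RegLev X.k`): the SAME theorem at every `j ≦ k` with the slot
constant `B′₁` of (1.62)/(1.67) (`|A| < B′₁(α₀ + α₁)(L^jη)⁻¹` on `Ω_j`, `j ≦ k`) and the smallness `2CdB′₁σ ≦ 1`
(a separate explicit constraint on `c₁`; stricter than the printed one when `B₁ ≦ B′₁`,
`smallness_rerun_implies_printed`); constants `α₃ = 16dB′₁(α₀ + α₁)`, `4dB′₁(α₀ + α₁)L^{n+1−j}`.  What it asks of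
the paper is only its hypothesis list: (106)–(108) of [3] for a `u` obeying (1.29)_k, the localised (130)–(131) of
[3] with the (1.62)-bound in the slot, and that smallness. [cite: Balaban1985RegularSpaces, proof of Thm 4 p.95, (1.62) p.87, (1.67) p.88] -/
theorem rerunRange_7374 (k : ℕ) (t : ℕ → ℕ → Finset ι) (wt : ℕ → ℕ → ι → ℝ) (X : ℕ → ℕ → ι → A)
    (xs : ℕ → ℕ → ι) (g : ℕ → ℕ → A) (M : ℕ → ℕ → ℝ) {d L B₁' σ C : ℝ} (hL : 2 ≤ L) (hd : 0 < d)
    (hB : 0 < B₁') (hσ : 0 < σ) (hC : 0 ≤ C) (hsmall : 2 * C * d * B₁' * σ ≤ 1)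
    (h : ∀ j ≤ k, Hyps7374 (t j) (wt j) (X j) (xs j) (g j) (M j) j d L B₁' σ C) :
    ∀ j ≤ k, Concl7374 (t j) (wt j) (X j) (xs j) (g j) j d L B₁' σ :=
  fun j hj => chain7374 (t j) (wt j) (X j) (xs j) (g j) (M j) j hL hd hB hσ hC hsmall (h j hj)

/-- The re-run's smallness implies the printed one when `B₁ ≦ B′₁`: the threshold on `σ = α₀ + α₁` only shrinks
(`σ ≦ 1/(2CdB′₁) ≦ 1/(2CdB₁)`) — the explicit extra constraint on `c₁` inside p. 95's "For α₀ + α₁ sufficiently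
small the assumptions of this proposition are satisfied". [cite: Balaban1985RegularSpaces, proof of Thm 4 p.95] -/
theorem smallness_rerun_implies_printed {C d B₁ B₁' σ : ℝ} (hC : 0 ≤ C) (hd : 0 ≤ d) (hσ : 0 ≤ σ)
    (hBB : B₁ ≤ B₁') (h : 2 * C * d * B₁' * σ ≤ 1) : 2 * C * d * B₁ * σ ≤ 1 := by
  have h0 : 0 ≤ 2 * C * d := by positivity
  have h1 : 2 * C * d * B₁ * σ ≤ 2 * C * d * B₁' * σ := by
    have := mul_le_mul_of_nonneg_left hBB h0
    exact mul_le_mul_of_nonneg_right this hσ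
  linarith

end Levels

end Literature.MathematicalPhysics.QuantumFieldTheory.Balaban1983to89.B8Ineq170
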